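import Summits.HodgeConjecture.CorCM.MumfordTateRankUnitaryPairSplitting
import Summits.HodgeConjecture.CorCM.MumfordTateRankUnitaryPairCentre
import Summits.HodgeConjecture.CorCM.MumfordTateRankUnitaryPairCount
import Summits.HodgeConjecture.CorCM.MumfordTateRankTypeIVThreefoldData
import Summits.HodgeConjecture.CorCM.MumfordTateRankSimpleThreefoldPairs
import Literature.AlgebraicGeometry.Motives.AbelianVarietyEndAlgebraIsogenyInvariance
import HarnessLib

/-!
# Two simple type-IV(2,1) threefolds: `t(T × T′) = 10 / 18 / 19` EXACTLY, as `T ∼ T′` / `T ≁ T′` with isomorphic fields / different fields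
# (the unitary Lemma (3.4): `Hg(T × T′) ⊇ SU(H¹T) × SU(H¹T′)`, and the centre is one torus iff the imaginary quadratic fields coincide)

COR-CM (cell `pub-hodgecm2`, seat `b27` gen 52, count-neutral Mumford–Tate-rank ladder; theorems only, no definition, no named fact; UNCONDITIONAL —
nothing here uses or asserts HC_CM).  `t := dim MT(H¹·)`.  For SIMPLE complex abelian threefolds `T`, `T′` with `dim_ℚ End⁰ = 2` (type IV(2,1),
`t(T) = t(T′) = 10`): the tree knew `t(T × T′) = 10` for `T ∼ T′`, `10 ≤ t ≤ 19` in general and `t ≤ 18` when `End⁰T ≅ End⁰T′`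
(`CorCM/MumfordTateRankSimpleThreefoldPairs`, `CorCM/MumfordTateRankTypeIVThreefoldPairs{,Cells}`: the Weil classes of the diagonal action).
HERE the matching lower bounds, closing the `{3,3}` cell IV × IV of the ladder: **`t(T × T′) = 18` if `T ≁ T′` and `End⁰T ≅ End⁰T′`, and
`t(T × T′) = 19` if `End⁰T ≇ End⁰T′`.**  LOWER BOUNDS (the unitary analogue of Moonen–Zarhin's Lemma (3.4) and Prop. (3.8),
`CorCM/MumfordTateRankUnitaryPair{Blocks,Intertwiner,Descent,Graph,Splitting,Centre,Count}`, `Algebra/Lie/LineGradedIntertwiner`, fed with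
`CorCM/MumfordTateRankTypeIVThreefoldData`): the derived algebras `𝔡_i = [Lie Hg(H¹T_i), Lie Hg(H¹T_i)]` are simple of dimension `8`, the factors
are `Θ`-rigid with skew centres `ℚφ_i^*`, and a non-zero Hodge morphism `H¹T → H¹T′` would come from `Hom(T′, T) ≠ 0` (Riemann); so
`Lie Hg(H¹(T × T′)) ⊇ ι₁𝔡₁π₁ ⊕ ι₂𝔡₂π₂` plus a central LINE (`dim ≥ 17`), and plus the central PLANE `ℚφ̂₁ ⊕ ℚφ̂₂` when `d₁/d₂ ∉ (ℚ^×)²`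
(trace test `tr(Θ_{T_i}φ_i^*) = ±2i√d_i`: `dim ≥ 18`).
* §1 **`finrank_hodgeLie_hodge_one_prod_typeIV_threefolds_ge`** — `dim Lie Hg(H¹(T × T′)) ≥ 17` for `T ≁ T′`, and `≥ 18` if moreover
  there is no ring homomorphism `End⁰T′ → End⁰T`.
* §2 **`mtRank_hodge_one_eq_eighteen_of_isIsogenous_prod_typeIV_threefolds`** (`End⁰T′ → End⁰T`, `T ≁ T′`, `X ∼ T × T′`: `t(X) = 18`);
  **`mtRank_hodge_one_eq_nineteen_of_isIsogenous_prod_typeIV_threefolds`** (no `End⁰T′ → End⁰T`: `t(X) = 19`);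
  **`mtRank_hodge_one_trichotomy_of_isIsogenous_prod_typeIV_threefolds`** (`t ∈ {10, 18, 19}` with the three criteria).

## References
* [MoonenZarhin1999LowDim] B. Moonen, Yu. G. Zarhin, *Hodge classes on abelian varieties of low dimension*, Math. Ann. 315 (1999), §3 (3.1),
  Lemma (3.4), Prop. (3.8), §2 (2.3), Thm. 0.1 (4) [corpus: paper:arxiv-math_9901113 pp. 1–7]. [cite: MoonenZarhin1999LowDim, §3 (3.1), Lemma (3.4) and Prop. (3.8)]
* [Ribet1983] K. A. Ribet, Amer. J. Math. 105 (1983), Thm. 3. [cite: Ribet1983, Thm. 3]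
* [Deligne1982HodgeCycles] P. Deligne, LNM 900 (1982), I §3 Prop. 3.4, Prop. 3.6, §4 Prop. 4.4. [cite: Deligne1982HodgeCycles, I §3 Prop. 3.6]
* [DeligneMilne1982Tannakian] P. Deligne, J. Milne, LNM 900 (1982), §6 Thm. 6.20 (Riemann). [cite: DeligneMilne1982Tannakian, §6 Thm. 6.20]
* [MumfordAV1970] D. Mumford, *Abelian varieties*, §19 (isogenous varieties have isomorphic `End⁰`). [cite: MumfordAV1970, §19]
-/

noncomputable section

open scoped TensorProduct
open CategoryTheory CategoryTheory.Limits Module NumberField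

namespace Summit.HodgeConjecture.CorCM

open Literature.AlgebraicGeometry.Motives
open Literature.AlgebraicGeometry.Motives.AbelianVariety
open Literature.AlgebraicGeometry.Motives.HodgeStructure
open Literature.AlgebraicGeometry.HodgeTheory
open Literature.AlgebraicGeometry.ComplexMultiplication
open Literature.AlgebraicGeometry.Milne1999 (hom_eq_zero_of_isSimple_of_not_isIsogenous)

variable [HodgeTensorFacts.{0, 0}] {X : AbelianVariety ℂ} {n : ℕ}

/-! ## §1 The lower bounds `dim Lie Hg(H¹(T × T′)) ≥ 17`, and `≥ 18` for different fields -/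

set_option maxHeartbeats 800000 in
/-- **`dim Lie Hg(H¹(T × T′)) ≥ 17` for two NON-ISOGENOUS simple type-IV(2,1) threefolds, and `≥ 18` when there is no ring homomorphism
`End⁰T′ → End⁰T`**: `UnitaryPair.corners_le_and_finrank_le` (both derived corners `8 + 8` and a central line), and for different fields
`UnitaryPair.incl_phi_proj_mem_hodgeLie_of_nonresonant` + `UnitaryPair.finrank_add_finrank_add_two_le_of_corners` (the central plane), fed with
`typeIV_threefold_factor_data`, `derived_facts_of_isSimple_threefold` and Riemann's theorem (`Hom(T′, T) = 0`).
[cite: MoonenZarhin1999LowDim, §3 (3.1), Lemma (3.4) and Prop. (3.8)] [cite: DeligneMilne1982Tannakian, §6 Thm. 6.20] [cite: Ribet1983, Thm. 3] -/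
theorem finrank_hodgeLie_hodge_one_prod_typeIV_threefolds_ge {T T' : AbelianVariety ℂ} {m : ℕ} (hP : IsSmoothProjective m (T.prod T').X)
    (hTs : T.IsSimple) (hT3 : T.dim = 3) (hTE : Module.finrank ℚ T.endAlgebra = 2) (hT's : T'.IsSimple) (hT'3 : T'.dim = 3)
    (hT'E : Module.finrank ℚ T'.endAlgebra = 2) (hni : ¬ IsIsogenous T T') :
    haveI := BettiUniverse.finite hP 1
    17 ≤ Module.finrank ℚ (BettiUniverse.hodge exists_isReal_hodgeModel_holds hP 1).hodgeLie ∧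
      (IsEmpty (T'.endAlgebra →+* T.endAlgebra) → 18 ≤ Module.finrank ℚ (BettiUniverse.hodge exists_isReal_hodgeModel_holds hP 1).hodgeLie) := by
  classical
  have hnP : (T.prod T').dim = m := schemeDim_eq_holds hP
  subst hnP
  have hT : IsSmoothProjective T.dim T.X := AbelianVariety.isSmoothProjective_holds
  have hT' : IsSmoothProjective T'.dim T'.X := AbelianVariety.isSmoothProjective_holds
  haveI := BettiUniverse.finite hP 1
  haveI := BettiUniverse.finite hT 1
  haveI := BettiUniverse.finite hT' 1
  haveI : Nontrivial (bettiCohomology T.X 1) := Module.nontrivial_of_finrank_pos (R := ℚ) (by rw [finrank_bettiCohomology_one T]; omega)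
  haveI : Nontrivial (bettiCohomology T'.X 1) := Module.nontrivial_of_finrank_pos (R := ℚ) (by rw [finrank_bettiCohomology_one T']; omega)
  -- per-factor data
  obtain ⟨χ₁, d₁, φ₁, μ₁, k₁, hd₁, hχ₁, hφχ₁, hφ₁E, hφ₁2, hE₁, hμ₁, h1₁, h2₁, hφ₁𝔥, hZ₁, hσ₁, hk₁, hτ₁⟩ := typeIV_threefold_factor_data hT hTs hT3 hTE
  obtain ⟨χ₂, d₂, φ₂, μ₂, k₂, hd₂, hχ₂, hφχ₂, hφ₂E, hφ₂2, hE₂, hμ₂, h1₂, h2₂, -, hZ₂, hσ₂, hk₂, hτ₂⟩ := typeIV_threefold_factor_data hT' hT's hT'3 hT'E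
  obtain ⟨hsimple₁, hcent₁, h8₁⟩ := derived_facts_of_isSimple_threefold hT hTs hT3 hTE
  obtain ⟨hsimple₂, hcent₂, h8₂⟩ := derived_facts_of_isSimple_threefold hT' hT's hT'3 hT'E
  obtain ⟨ψ₁⟩ := BettiUniverse.hodge_isPolarizable exists_isReal_hodgeModel_holds hT 1
  obtain ⟨ψ₂⟩ := BettiUniverse.hodge_isPolarizable exists_isReal_hodgeModel_holds hT' 1
  obtain ⟨ψ⟩ := BettiUniverse.hodge_isPolarizable exists_isReal_hodgeModel_holds hP 1
  have heff₁ := BettiUniverse.hodge_isEffective exists_isReal_hodgeModel_holds hT 1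
  have heff₂ := BettiUniverse.hodge_isEffective exists_isReal_hodgeModel_holds hT' 1
  have hd₁Q : (0 : ℚ) < d₁ := Nat.cast_pos.2 hd₁
  have hd₂Q : (0 : ℚ) < d₂ := Nat.cast_pos.2 hd₂
  -- the bicone of `H¹(T × T')`
  let ι₁ := BettiUniverse.pullHodgeHom exists_isReal_hodgeModel_holds hodgePQ_independent_of_hodgeModel_holds hP hT (fst T T').hom.hom.hom 1
  let π₁ := BettiUniverse.pullHodgeHom exists_isReal_hodgeModel_holds hodgePQ_independent_of_hodgeModel_holds hT hP
    (prodLift (𝟙 T) (0 : T ⟶ T')).hom.hom.hom 1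
  let ι₂ := BettiUniverse.pullHodgeHom exists_isReal_hodgeModel_holds hodgePQ_independent_of_hodgeModel_holds hP hT' (snd T T').hom.hom.hom 1
  let π₂ := BettiUniverse.pullHodgeHom exists_isReal_hodgeModel_holds hodgePQ_independent_of_hodgeModel_holds hT' hP
    (prodLift (0 : T' ⟶ T) (𝟙 T')).hom.hom.hom 1
  have hsumP : fst T T' ≫ prodLift (𝟙 T) (0 : T ⟶ T') + snd T T' ≫ prodLift (0 : T' ⟶ T) (𝟙 T') = 𝟙 _ := by
    refine prod_hom_ext ?_ ?_
    · rw [Preadditive.add_comp, Category.assoc, Category.assoc, prodLift_fst, prodLift_fst, Category.comp_id, comp_zero, add_zero, Category.id_comp]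
    · rw [Preadditive.add_comp, Category.assoc, Category.assoc, prodLift_snd, prodLift_snd, Category.comp_id, comp_zero, zero_add, Category.id_comp]
  have hπι₁ : ∀ v, π₁.toLinearMap (ι₁.toLinearMap v) = v := fun v => pull_pull_eq_self_of_comp_eq_id (prodLift_fst _ _) v
  have hπι₂ : ∀ v, π₂.toLinearMap (ι₂.toLinearMap v) = v := fun v => pull_pull_eq_self_of_comp_eq_id (prodLift_snd _ _) v
  have hsum : ∀ v, ι₁.toLinearMap (π₁.toLinearMap v) + ι₂.toLinearMap (π₂.toLinearMap v) = v := fun v =>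
    pull_pull_add_pull_pull_eq_self _ _ _ _ hsumP v
  -- the skew centre of `Lie Hg(H¹(T × T'))` is on `ℚ ι₁φ₁π₁ + ℚ ι₂φ₂π₂`
  have hZ : ∀ z ∈ (BettiUniverse.hodge exists_isReal_hodgeModel_holds hP 1).hodgeLie ⊓
      Subalgebra.toSubmodule (BettiUniverse.hodge exists_isReal_hodgeModel_holds hP 1).endAlg, ∃ x₁ x₂ : ℚ,
      z = x₁ • (ι₁.toLinearMap ∘ₗ φ₁ ∘ₗ π₁.toLinearMap) + x₂ • (ι₂.toLinearMap ∘ₗ φ₂ ∘ₗ π₂.toLinearMap) := by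
    intro z hz
    obtain ⟨hz𝔥, hzE⟩ := Submodule.mem_inf.1 hz
    rw [Subalgebra.mem_toSubmodule] at hzE
    have hb := eq_sum_blocks_of_mem_hodgeLie ι₁ π₁ ι₂ π₂ hπι₁ hπι₂ hsum hz𝔥
    obtain ⟨x₁, hx₁⟩ := hZ₁ ψ₁ _ (Submodule.mem_inf.2 ⟨comp_mem_hodgeLie_of_retract ι₁ π₁ hπι₁ hz𝔥,
      ((π₁.comp (endAlg.toHom ⟨z, hzE⟩)).comp ι₁).toLinearMap_mem_endAlg⟩)
    obtain ⟨x₂, hx₂⟩ := hZ₂ ψ₂ _ (Submodule.mem_inf.2 ⟨comp_mem_hodgeLie_of_retract ι₂ π₂ hπι₂ hz𝔥,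
      ((π₂.comp (endAlg.toHom ⟨z, hzE⟩)).comp ι₂).toLinearMap_mem_endAlg⟩)
    refine ⟨x₁, x₂, ?_⟩
    rw [hb, hx₁, hx₂]
    simp only [LinearMap.smul_comp, LinearMap.comp_smul]
  -- no non-zero Hodge morphism `H¹T → H¹T'` (Riemann: it would be `u^*`, `u : T' → T`, and `Hom(T', T) = 0`)
  have hTT : ∀ u : T' ⟶ T, u = 0 := hom_eq_zero_of_isSimple_of_not_isIsogenous hT's hTs (fun h => hni h.symm')
  have hnohom : ∀ f : bettiCohomology T.X 1 →ₗ[ℚ] bettiCohomology T'.X 1,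
      (∀ r : ℤ, ∀ x ∈ (BettiUniverse.hodge exists_isReal_hodgeModel_holds hT 1).piece r (((1 : ℕ) : ℤ) - r),
        f.baseChange ℂ x ∈ (BettiUniverse.hodge exists_isReal_hodgeModel_holds hT' 1).piece r (((1 : ℕ) : ℤ) - r)) → f = 0 := by
    intro f hf
    refine forall_isHodgeMorphismOne_eq_zero_of_forall_hom_eq_zero hTT f ⟨fun x hx => ?_, fun x hx => ?_⟩
    · have hx' := (BettiUniverse.mem_hodge_piece_iff exists_isReal_hodgeModel_holds hodgePQ_independent_of_hodgeModel_holds hT (k := 1)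
        (p := 1) (q := 0) rfl _).2 hx
      have e : (((1 : ℕ) : ℤ) - 1) = 0 := by norm_num
      have h := hf 1 x (by rw [e]; exact hx')
      rw [e] at h
      exact (BettiUniverse.mem_hodge_piece_iff exists_isReal_hodgeModel_holds hodgePQ_independent_of_hodgeModel_holds hT' (k := 1)
        (p := 1) (q := 0) rfl _).1 h
    · have hx' := (BettiUniverse.mem_hodge_piece_iff exists_isReal_hodgeModel_holds hodgePQ_independent_of_hodgeModel_holds hT (k := 1)
        (p := 0) (q := 1) rfl _).2 hx
      have e : (((1 : ℕ) : ℤ) - 0) = 1 := by norm_num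
      have h := hf 0 x (by rw [e]; exact hx')
      rw [e] at h
      exact (BettiUniverse.mem_hodge_piece_iff exists_isReal_hodgeModel_holds hodgePQ_independent_of_hodgeModel_holds hT' (k := 1)
        (p := 0) (q := 1) rfl _).1 h
  have h𝔡₁0 : Submodule.span ℚ {B | ∃ X' ∈ (BettiUniverse.hodge exists_isReal_hodgeModel_holds hT 1).hodgeLie,
      ∃ Y ∈ (BettiUniverse.hodge exists_isReal_hodgeModel_holds hT 1).hodgeLie, X' * Y - Y * X' = B} ≠ ⊥ := fun h => by
    rw [h, finrank_bot] at h8₁; omega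
  have h𝔡₂0 : Submodule.span ℚ {B | ∃ X' ∈ (BettiUniverse.hodge exists_isReal_hodgeModel_holds hT' 1).hodgeLie,
      ∃ Y ∈ (BettiUniverse.hodge exists_isReal_hodgeModel_holds hT' 1).hodgeLie, X' * Y - Y * X' = B} ≠ ⊥ := fun h => by
    rw [h, finrank_bot] at h8₂; omega
  obtain ⟨hc₁, hc₂, hdim⟩ := UnitaryPair.corners_le_and_finrank_le ι₁ π₁ ι₂ π₂ hπι₁ hπι₂ hsum Nat.cast_one heff₁ heff₂ ψ₁ ψ₂ ψ hφ₁E hd₁Q hφ₁2 hE₁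
    hμ₁ h1₁ h2₁ hφ₂E hd₂Q hφ₂2 hE₂ hμ₂ h1₂ h2₂ (hodgeLie_rigid_of_isSimple_threefold_of_finrank_endAlgebra_eq_two hT hTs hT3 hTE)
    (hodgeLie_rigid_of_isSimple_threefold_of_finrank_endAlgebra_eq_two hT' hT's hT'3 hT'E) hZ hφ₁𝔥 (hZ₁ ψ₁) (hZ₂ ψ₂) hsimple₁ hsimple₂
    hcent₁ hcent₂ h𝔡₁0 h𝔡₂0 hnohom
  rw [h8₁, h8₂] at hdim
  refine ⟨hdim, fun hfor => ?_⟩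
  -- different fields: the central plane
  have hfree : ∀ s : ℚ, (d₁ : ℚ) ≠ s ^ 2 * d₂ := forall_ne_sq_mul_of_isEmpty_ringHom hfor hT'E hd₂ hχ₂ hχ₁ hd₁
  obtain ⟨hE₁𝔥, hE₂𝔥⟩ := UnitaryPair.incl_phi_proj_mem_hodgeLie_of_nonresonant ι₁ π₁ ι₂ π₂ hπι₁ hπι₂ hsum hφ₁E hφ₂E ψ hZ hd₁Q hφ₁2 hd₂Q hφ₂2
    hσ₁ hσ₂ hk₁ hk₂ hτ₁ hτ₂ hfree
  have h := UnitaryPair.finrank_add_finrank_add_two_le_of_corners ι₁ π₁ ι₂ π₂ hπι₁ hπι₂ hsum hφ₁E hφ₂E hd₁Q hφ₁2 hd₂Q hφ₂2 hc₁ hc₂ hE₁𝔥 hE₂𝔥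
  rw [h8₁, h8₂] at h
  exact h

/-! ## §2 The cells `18` and `19`, and the trichotomy -/

/-- **`t(X) = 18` for `X ∼ T × T′`, `T`, `T′` NON-ISOGENOUS simple abelian threefolds with `dim_ℚ End⁰ = 2` and ISOMORPHIC fields `End⁰T′ → End⁰T`**
(`Hg(T × T′)`: the two special unitary groups and ONE central torus — the Weil classes of the diagonal action cut the second torus,
`CorCM/MumfordTateRankTypeIVThreefoldPairs`; the unitary Lemma (3.4) forces both special unitary factors).
[cite: MoonenZarhin1999LowDim, §3 (3.1) and Lemma (3.4)] [cite: Deligne1982HodgeCycles, §4 Prop. 4.4] -/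
theorem mtRank_hodge_one_eq_eighteen_of_isIsogenous_prod_typeIV_threefolds (hX : IsSmoothProjective n X.X) {T T' : AbelianVariety ℂ}
    (hTs : T.IsSimple) (hT3 : T.dim = 3) (hTE : Module.finrank ℚ T.endAlgebra = 2) (hT's : T'.IsSimple) (hT'3 : T'.dim = 3)
    (hT'E : Module.finrank ℚ T'.endAlgebra = 2) (hfor : Nonempty (T'.endAlgebra →+* T.endAlgebra)) (hni : ¬ IsIsogenous T T')
    (hXP : IsIsogenous X (T.prod T')) :
    haveI := BettiUniverse.finite hX 1
    (BettiUniverse.hodge exists_isReal_hodgeModel_holds hX 1).mtRank = 18 := by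
  haveI := BettiUniverse.finite hX 1
  have hP : IsSmoothProjective (T.prod T').dim (T.prod T').X := AbelianVariety.isSmoothProjective_holds
  haveI := BettiUniverse.finite hP 1
  have hle := mtRank_hodge_one_le_eighteen_of_isIsogenous_prod_typeIV_threefolds_of_nonempty_ringHom hX hTs hT3 hTE hT's hT'3 hT'E hfor hXP
  have h0 : 0 < X.dim := by
    obtain ⟨g, hg⟩ := hXP
    rw [dim_eq_of_isIsogeny hg, dim_prod]; omega
  have h17 := (finrank_hodgeLie_hodge_one_prod_typeIV_threefolds_ge hP hTs hT3 hTE hT's hT'3 hT'E hni).1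
  rw [← finrank_hodgeLie_hodge_one_eq_of_isIsogenous hX hP hXP] at h17
  rw [mtRank_hodge_one_eq_finrank_hodgeLie_add_one hX h0] at hle ⊢
  omega

/-- **`t(X) = 19` for `X ∼ T × T′`, `T`, `T′` simple abelian threefolds with `dim_ℚ End⁰ = 2` and NON-ISOMORPHIC fields** (no ring homomorphism
`End⁰T′ → End⁰T`; then `T ≁ T′` automatically, Mumford §19): `Hg(T × T′) = U(H¹T) × U(H¹T′)` has dimension `9 + 9`.
[cite: MoonenZarhin1999LowDim, §3 (3.1) and Prop. (3.8)] [cite: MumfordAV1970, §19] -/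
theorem mtRank_hodge_one_eq_nineteen_of_isIsogenous_prod_typeIV_threefolds (hX : IsSmoothProjective n X.X) {T T' : AbelianVariety ℂ}
    (hTs : T.IsSimple) (hT3 : T.dim = 3) (hTE : Module.finrank ℚ T.endAlgebra = 2) (hT's : T'.IsSimple) (hT'3 : T'.dim = 3)
    (hT'E : Module.finrank ℚ T'.endAlgebra = 2) (hfor : IsEmpty (T'.endAlgebra →+* T.endAlgebra)) (hXP : IsIsogenous X (T.prod T')) :
    haveI := BettiUniverse.finite hX 1
    (BettiUniverse.hodge exists_isReal_hodgeModel_holds hX 1).mtRank = 19 := by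
  haveI := BettiUniverse.finite hX 1
  have hP : IsSmoothProjective (T.prod T').dim (T.prod T').X := AbelianVariety.isSmoothProjective_holds
  haveI := BettiUniverse.finite hP 1
  have hni : ¬ IsIsogenous T T' := fun h => by
    obtain ⟨e⟩ := h.nonempty_endAlgebra_algEquiv
    exact hfor.false (e.symm : T'.endAlgebra →+* T.endAlgebra)
  have hle := (mtRank_hodge_one_mem_Icc_of_isIsogenous_prod_typeIV_threefolds hX hTs hT3 hTE hT's hT'3 hT'E hXP).2
  have h0 : 0 < X.dim := by
    obtain ⟨g, hg⟩ := hXP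
    rw [dim_eq_of_isIsogeny hg, dim_prod]; omega
  have h18 := (finrank_hodgeLie_hodge_one_prod_typeIV_threefolds_ge hP hTs hT3 hTE hT's hT'3 hT'E hni).2 hfor
  rw [← finrank_hodgeLie_hodge_one_eq_of_isIsogenous hX hP hXP] at h18
  rw [mtRank_hodge_one_eq_finrank_hodgeLie_add_one hX h0] at hle ⊢
  omega

/-- **Trichotomy for two simple type-IV(2,1) threefolds: `t(T × T′) = 10`, `18` or `19`** according as `T ∼ T′`; `T ≁ T′` with isomorphic
fields; non-isomorphic fields. [cite: MoonenZarhin1999LowDim, §3 (3.1), Lemma (3.4), Prop. (3.8) and Thm. 0.1 (4)] -/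
theorem mtRank_hodge_one_trichotomy_of_isIsogenous_prod_typeIV_threefolds (hX : IsSmoothProjective n X.X) {T T' : AbelianVariety ℂ}
    (hTs : T.IsSimple) (hT3 : T.dim = 3) (hTE : Module.finrank ℚ T.endAlgebra = 2) (hT's : T'.IsSimple) (hT'3 : T'.dim = 3)
    (hT'E : Module.finrank ℚ T'.endAlgebra = 2) (hXP : IsIsogenous X (T.prod T')) :
    haveI := BettiUniverse.finite hX 1
    (IsIsogenous T T' ∧ (BettiUniverse.hodge exists_isReal_hodgeModel_holds hX 1).mtRank = 10) ∨
      (¬ IsIsogenous T T' ∧ Nonempty (T'.endAlgebra →+* T.endAlgebra) ∧ (BettiUniverse.hodge exists_isReal_hodgeModel_holds hX 1).mtRank = 18) ∨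
      (IsEmpty (T'.endAlgebra →+* T.endAlgebra) ∧ (BettiUniverse.hodge exists_isReal_hodgeModel_holds hX 1).mtRank = 19) := by
  haveI := BettiUniverse.finite hX 1
  by_cases hTT' : IsIsogenous T T'
  · left
    have hT : IsSmoothProjective T.dim T.X := AbelianVariety.isSmoothProjective_holds
    haveI := BettiUniverse.finite hT 1
    refine ⟨hTT', ?_⟩
    rw [mtRank_hodge_one_eq_of_isIsogenous_prod_threefolds_of_isIsogenous hX hT hT3 hTT' hXP]
    exact (mtRank_hodge_one_of_isSimple_threefold_of_finrank_endAlgebra_eq_two hT hTs hT3 hTE).1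
  · right
    rcases isEmpty_or_nonempty (T'.endAlgebra →+* T.endAlgebra) with hfor | hfor
    · exact Or.inr ⟨hfor, mtRank_hodge_one_eq_nineteen_of_isIsogenous_prod_typeIV_threefolds hX hTs hT3 hTE hT's hT'3 hT'E hfor hXP⟩
    · exact Or.inl ⟨hTT', hfor, mtRank_hodge_one_eq_eighteen_of_isIsogenous_prod_typeIV_threefolds hX hTs hT3 hTE hT's hT'3 hT'E hfor hTT' hXP⟩

end Summit.HodgeConjecture.CorCM

end
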